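import Literature.NumberTheory.EllipticCurves.CoatesGreenberg1996.CyclotomicZpExtensionDeeplyRamified
import Literature.NumberTheory.PAdicHodge.TateAlmostEtaleLocalField
import Literature.NumberTheory.GaloisRepresentations.PadicAlgebraOfLocalField
import Mathlib.Analysis.AbsoluteValue.Equivalence
import HarnessLib

/-!
# Proof of `deeplyRamified_cyclotomicZpExtension_trace` (Greenberg LNM 1716 p. 84 / [CoGr] Thm. 2.13)

We discharge the named fact `CoatesGreenberg1996.deeplyRamified_cyclotomicZpExtension_trace`
(universe `0`) — **the cyclotomic `ℤ_p`-extension `K_v K_∞` of `K_v` (`v ∣ p`) is deeply ramified,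
trace form** — from the PAdicHodge formalisation of Tate's almost étale lemma
(`TateAlmostEtale.exists_integral_fixed_norm_orbitSum_gt`, Tate 1967 §3.2 Prop. 9), through three
identifications:

* `cyclotomicCharacter_resGal` : `χ_K ∘ res_v = χ_{K_v}` on `Γ_{K_v}`, whence the local group
  `(ker κ)_v` of the cyclotomic `κ` is `{σ : χ(σ) torsion}` (`mem_localSubgroup_kerSubgroup_iff`);
* `exists_norm_eq_spectralNorm_rpow` : the absolute value of the normed closure `NormedAlgClosure K_v`
  is a positive power of the spectral norm of `K̄_v` for Mathlib's normed structure of `K_v` (both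
  extend absolute values of `K_v` with the same unit ball);
* the Galois actions on `NormedAlgClosure K_v = K̄_v` agree (definitionally).

No `sorry`, no new definitions.  Honest scope: universe `0` only (the PAdicHodge framework is typed
over `F : Type`); this is what the Coates–Greenberg input (I2) over `ℚ` consumes.

§4 closes the loop with the reduction already proved in `CyclotomicZpExtensionDeeplyRamified`
(`deeplyRamified_cyclotomic_trace_of_cyclotomicZpExtension`): the GENERAL record
`CoatesGreenberg1996.deeplyRamified_cyclotomic_trace` (every closed `G ≤ (ker κ)_v`, every open `O`)
holds at universe `0` — `deeplyRamified_cyclotomic_trace_holds`.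

References: J. Tate, *p-divisible groups* (1967) §3.2 [Tate1967]; R. Greenberg, LNM 1716 (1999) §2
p. 84 [GreenbergLNM1716]; J. Coates, R. Greenberg (1996) §2 Thm. 2.13 [CoatesGreenberg1996].
-/

noncomputable section

open scoped Classical NNReal

open NumberField IsDedekindDomain Field Literature.NumberTheory.GaloisRepresentations
  Literature.NumberTheory.EllipticCurves Literature.NumberTheory.PAdicHodge ValuativeRel

namespace Literature.NumberTheory.EllipticCurves.CoatesGreenberg1996

/-! ## §1 `χ_K ∘ res_v = χ_{K_v}` -/

/-- **The cyclotomic character is compatible with restriction to a decomposition group**: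
`χ_K(res_v τ) = χ_{K_v}(τ)` for `τ ∈ Γ_{K_v}` (both are read off from the action on the `p`-power
roots of unity, and `closureEmb : K̄ → K̄_v` maps primitive roots to primitive roots).
[cite: Washington1997, §13.1] [cite: GreenbergLNM1716, §3 Lemma 3.4 (p. 89)] -/
theorem cyclotomicCharacter_resGal {K : Type} [Field K] [NumberField K] (v : HeightOneSpectrum (𝓞 K))
    (p : ℕ) [hp : Fact p.Prime] (τ : absoluteGaloisGroup (v.adicCompletion K)) :
    GaloisRep.cyclotomicCharacter K p (resGal (K := K) (v.adicCompletion K) τ) =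
      GaloisRep.cyclotomicCharacter (v.adicCompletion K) p τ := by
  have hpp := hp.out
  haveI : CharZero (v.adicCompletion K) := LocalField.charZero_adicCompletion v
  haveI : NeZero (p : K) := ⟨Nat.cast_ne_zero.mpr hpp.ne_zero⟩
  haveI : NeZero (p : v.adicCompletion K) := ⟨Nat.cast_ne_zero.mpr hpp.ne_zero⟩
  set σ : absoluteGaloisGroup K := resGal (K := K) (v.adicCompletion K) τ with hσdef
  refine Units.ext (PadicInt.ext_of_toZModPow.mp fun k ↦ ?_)
  cases k with
  | zero =>
    haveI : Subsingleton (ZMod (p ^ 0)) := by rw [pow_zero]; infer_instance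
    exact Subsingleton.elim _ _
  | succ k =>
    haveI : NeZero ((p ^ (k + 1) : ℕ) : AlgebraicClosure K) :=
      ⟨by exact_mod_cast pow_ne_zero (k + 1) hpp.ne_zero⟩
    obtain ⟨t, ht⟩ := HasEnoughRootsOfUnity.exists_primitiveRoot (AlgebraicClosure K) (p ^ (k + 1))
    set ξ : AlgebraicClosure (v.adicCompletion K) := closureEmb (K := K) (v.adicCompletion K) t with hξ
    have hξprim : IsPrimitiveRoot ξ (p ^ (k + 1)) :=
      ht.map_of_injective (closureEmb (K := K) (v.adicCompletion K)).toRingHom.injective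
    have h1 : closureEmb (K := K) (v.adicCompletion K) (σ • t) = τ • ξ :=
      AlgHom.congr_fun (closureEmb_comp_resGalAux (K := K) (v.adicCompletion K) τ) t
    have hK := GaloisRep.cyclotomicCharacter_spec K p (k := k + 1) σ t ht.pow_eq_one
    have hF := GaloisRep.cyclotomicCharacter_spec (v.adicCompletion K) p (k := k + 1) τ ξ hξprim.pow_eq_one
    have hpow : ξ ^ ((GaloisRep.cyclotomicCharacter K p σ).val.toZModPow (k + 1)).val =
        ξ ^ ((GaloisRep.cyclotomicCharacter (v.adicCompletion K) p τ).val.toZModPow (k + 1)).val := by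
      rw [← hF, ← h1, hK, map_pow]
    have hlt : 1 < p ^ (k + 1) := Nat.one_lt_pow (by omega) hpp.one_lt
    haveI : Fact (1 < p ^ (k + 1)) := ⟨hlt⟩
    have hc := hξprim.pow_inj (ZMod.val_lt _) (ZMod.val_lt _) hpow
    exact ZMod.val_injective _ hc

/-- **The local group of the cyclotomic `ℤ_p`-extension**: for `κ` cyclotomic,
`τ ∈ (ker κ)_v ↔ χ(τ)` is a root of unity, `χ` the cyclotomic character of `G₀ ⊇ Γ_{K_v}`
(PAdicHodge `baseCyclotomicCharacter`). [cite: Washington1997, §13.1] [cite: GreenbergLNM1716, §1] -/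
theorem mem_localSubgroup_kerSubgroup_iff {K : Type} [Field K] [NumberField K]
    (v : HeightOneSpectrum (𝓞 K)) (p : ℕ) [Fact p.Prime] {κ : ZpExtension K p} (hκ : κ.IsCyclotomic)
    [CharZero (v.adicCompletion K)] (hp : valuation (v.adicCompletion K) p < 1)
    (τ : absoluteGaloisGroup (v.adicCompletion K)) :
    τ ∈ localSubgroup κ.kerSubgroup (v.adicCompletion K) ↔
      IsOfFinOrder (BaseGaloisGroup.baseCyclotomicCharacter hp (BaseGaloisGroup.toBase hp τ)) := by
  rw [mem_localSubgroup_iff, show κ.kerSubgroup = _ from hκ, Subgroup.mem_comap, CommGroup.mem_torsion,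
    BaseGaloisGroup.baseCyclotomicCharacter_toBase, ← cyclotomicCharacter_resGal v p τ]
  rfl

/-! ## §2 The two absolute values of `K̄_v` -/

/-- **The absolute value of `NormedAlgClosure K_v` is a positive power of the spectral norm for
Mathlib's normed structure of `K_v`**: both restrict on `K_v` to absolute values with unit ball
`𝒪_v`, hence are equivalent (`AbsoluteValue.isEquiv_iff_exists_rpow_eq`), and the spectral norm of
`z` is `|a₀(z)|^{1/deg}` for either (`spectralNorm_eq_norm_coeff_zero_rpow`).
[cite: NeukirchANT1999, Ch. II (4.8) with (3.7)] -/
theorem exists_norm_eq_spectralNorm_rpow {K : Type} [Field K] [NumberField K]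
    (v : HeightOneSpectrum (𝓞 K)) :
    ∃ c : ℝ, 0 < c ∧ ∀ z : NormedAlgClosure (v.adicCompletion K),
      ‖z‖ = (spectralNorm (v.adicCompletion K) (AlgebraicClosure (v.adicCompletion K)) z) ^ c := by
  -- the two absolute values of `K_v`: Mathlib's (`abv₁`) and the valuative one of PAdicHodge (`abv₂`)
  obtain ⟨abv₁, habv₁⟩ : ∃ abv : AbsoluteValue (v.adicCompletion K) ℝ, ∀ x, abv x = ‖x‖ :=
    ⟨{ toFun := fun x => ‖x‖
       map_mul' := norm_mul
       nonneg' := norm_nonneg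
       eq_zero' := fun _ => norm_eq_zero
       add_le' := norm_add_le }, fun _ => rfl⟩
  obtain ⟨abv₂, habv₂⟩ : ∃ abv : AbsoluteValue (v.adicCompletion K) ℝ, ∀ x, abv x =
      @norm (v.adicCompletion K)
        (IsNonarchimedeanLocalField.nontriviallyNormedField (v.adicCompletion K)).toNormedField.toNorm x := by
    letI : NormedField (v.adicCompletion K) :=
      (IsNonarchimedeanLocalField.nontriviallyNormedField (v.adicCompletion K)).toNormedField
    exact ⟨{ toFun := fun x => ‖x‖
             map_mul' := norm_mul
             nonneg' := norm_nonneg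
             eq_zero' := fun _ => norm_eq_zero
             add_le' := norm_add_le }, fun _ => rfl⟩
  -- same unit ball, hence equivalent
  have hlt₁ : ∀ x : v.adicCompletion K, ‖x‖ < 1 ↔ (Valued.v : Valuation (v.adicCompletion K) (WithZero (Multiplicative ℤ))) x < 1 :=
    fun x => Valued.toNormedField.norm_lt_one_iff
  have hlt₂ := fun x : v.adicCompletion K => IsNonarchimedeanLocalField.norm_lt_one_iff (F := v.adicCompletion K) x
  have hval : ∀ x : v.adicCompletion K, valuation (v.adicCompletion K) x < 1 ↔
      (Valued.v : Valuation (v.adicCompletion K) (WithZero (Multiplicative ℤ))) x < 1 :=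
    fun x => ((valuation (v.adicCompletion K)).vlt_one_iff (x := x)).symm.trans
      ((Valued.v : Valuation (v.adicCompletion K) (WithZero (Multiplicative ℤ))).vlt_one_iff (x := x))
  have hequiv : abv₁.IsEquiv abv₂ := by
    refine AbsoluteValue.isEquiv_iff_lt_one_iff.mpr fun x => ?_
    rw [habv₁, habv₂, hlt₁]
    exact ((hlt₂ x).trans (hval x)).symm
  obtain ⟨c, hc, hceq⟩ := AbsoluteValue.isEquiv_iff_exists_rpow_eq.mp hequiv
  have hbase : ∀ x : v.adicCompletion K, abv₂ x = ‖x‖ ^ c := by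
    intro x
    have := congrFun hceq x
    rw [← habv₁]; exact this.symm
  refine ⟨c, hc, fun z => ?_⟩
  -- spectral norms as `|a₀|^{1/deg}`: Mathlib side
  have h₁ : spectralNorm (v.adicCompletion K) (AlgebraicClosure (v.adicCompletion K)) z =
      ‖(minpoly (v.adicCompletion K) z).coeff 0‖ ^ (1 / (minpoly (v.adicCompletion K) z).natDegree : ℝ) := by
    letI := Valued.toNontriviallyNormedField (v.adicCompletion K) (WithZero (Multiplicative ℤ))
    exact spectralNorm.spectralNorm_eq_norm_coeff_zero_rpow (K := v.adicCompletion K)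
      (L := AlgebraicClosure (v.adicCompletion K)) (x := z)
  -- valuative side (the norm of `NormedAlgClosure K_v` is `algNorm K_v`, a spectral norm)
  have h₂ : ‖z‖ = (abv₂ ((minpoly (v.adicCompletion K) z).coeff 0)) ^
      (1 / (minpoly (v.adicCompletion K) z).natDegree : ℝ) := by
    letI := IsTopologicalAddGroup.rightUniformSpace (v.adicCompletion K)
    haveI := isUniformAddGroup_of_addCommGroup (G := v.adicCompletion K)
    rw [habv₂, NormedAlgClosure.norm_def, IsNonarchimedeanLocalField.algNorm_def]
    letI := IsNonarchimedeanLocalField.nontriviallyNormedField (v.adicCompletion K)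
    exact spectralNorm.spectralNorm_eq_norm_coeff_zero_rpow (K := v.adicCompletion K)
      (L := AlgebraicClosure (v.adicCompletion K)) (x := NormedAlgClosure.toAlgClosure z)
  rw [h₂, hbase, h₁, ← Real.rpow_mul (norm_nonneg _), ← Real.rpow_mul (norm_nonneg _), mul_comm]

/-! ## §3 The named fact -/

/-- **`deeplyRamified_cyclotomicZpExtension_trace` holds (universe `0`)**: Greenberg LNM 1716 p. 84 /
Coates–Greenberg Thm. 2.13 in trace form for `F_∞ = K_v K_∞`, from Tate's almost étale lemma
`TateAlmostEtale.exists_integral_fixed_norm_orbitSum_gt`.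
[cite: Tate1967, §3.2 Prop. 9] [cite: GreenbergLNM1716, §2 p. 84] [cite: CoatesGreenberg1996, §2 Thm. 2.13] -/
theorem deeplyRamified_cyclotomicZpExtension_trace_holds :
    deeplyRamified_cyclotomicZpExtension_trace.{0} := by
  intro K _ _ p _ κ hκ v hpv w hw N _ hNo _ ρ hρ
  have hpp : (Fact.out : p.Prime) = Fact.out := rfl
  haveI : CharZero (v.adicCompletion K) := LocalField.charZero_adicCompletion v
  have hp : valuation (v.adicCompletion K) p < 1 := LocalField.valuation_adicCompletion_natCast_lt_one v p hpv
  have hGF : ∀ σ, σ ∈ localSubgroup κ.kerSubgroup (v.adicCompletion K) ↔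
      IsOfFinOrder (BaseGaloisGroup.baseCyclotomicCharacter hp (BaseGaloisGroup.toBase hp σ)) :=
    fun σ => mem_localSubgroup_kerSubgroup_iff v p hκ hp σ
  obtain ⟨c, hc, hnorm⟩ := exists_norm_eq_spectralNorm_rpow v
  have hρc : ((ρ : ℝ)) ^ c < 1 := Real.rpow_lt_one ρ.2 (by exact_mod_cast hρ) hc
  obtain ⟨y, hy1, hyfix, hysum⟩ := TateAlmostEtale.exists_integral_fixed_norm_orbitSum_gt hp
    (localSubgroup κ.kerSubgroup (v.adicCompletion K)) hGF N hNo hρc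
  refine ⟨y, ?_, hyfix, ?_⟩
  · -- integrality
    have h := hnorm y
    rw [h, ← hw] at hy1
    have h2 : (w y : ℝ) ≤ 1 := by
      by_contra hlt
      push Not at hlt
      exact absurd hy1 (not_le.mpr (Real.one_lt_rpow hlt hc))
    exact_mod_cast h2
  · -- the trace
    have h := hnorm (∑ q : localSubgroup κ.kerSubgroup (v.adicCompletion K) ⧸
        N.subgroupOf (localSubgroup κ.kerSubgroup (v.adicCompletion K)),
      ((q.out : localSubgroup κ.kerSubgroup (v.adicCompletion K)) :
        absoluteGaloisGroup (v.adicCompletion K)) • y)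
    rw [h, ← hw] at hysum
    have h2 : (ρ : ℝ) < w (∑ q : localSubgroup κ.kerSubgroup (v.adicCompletion K) ⧸
        N.subgroupOf (localSubgroup κ.kerSubgroup (v.adicCompletion K)),
      ((q.out : localSubgroup κ.kerSubgroup (v.adicCompletion K)) :
        absoluteGaloisGroup (v.adicCompletion K)) • y) :=
      (Real.rpow_lt_rpow_iff ρ.2 (NNReal.coe_nonneg _) hc).mp hysum
    exact_mod_cast h2

/-! ## §4 The general record `deeplyRamified_cyclotomic_trace` -/

/-- **`deeplyRamified_cyclotomic_trace` holds (universe `0`)** — the trace form of "the fields between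
`K_v K_∞^{cyc}` and `K̄_v` are deeply ramified" (Coates–Greenberg 1996 §2 p. 143 (iii) with Thm. 2.13,
through Iovita–Zaharescu 1999 Thm. 1.2 (iii) / Def. 1.1 and Greenberg LNM 1716 p. 84): for `K` a
number field, `v ∣ p`, the cyclotomic `ℤ_p`-extension `κ`, EVERY closed `G ≤ (ker κ)_v`, EVERY open
`O ≤ Γ_{K_v}` with `G ∩ O` of finite index in `G` and every `ρ < 1`, there is an integral
`(O ∩ G)`-fixed `x ∈ K̄_v` with `ρ < |Σ_{q ∈ G/(G ∩ O)} q.out • x|_w`.  Proof: the base instance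
`deeplyRamified_cyclotomicZpExtension_trace_holds` (§3, Tate's almost étale lemma) fed to the
reduction `deeplyRamified_cyclotomic_trace_of_cyclotomicZpExtension` (file
`CyclotomicZpExtensionDeeplyRamified`, its module docstring §3: an open normal `N ≤ O`, coset
bookkeeping, the ultrametric inequality and Galois invariance of the spectral valuation).  Honest
scope as in §3: universe `0` (the PAdicHodge framework is typed over `F : Type`).
[cite: CoatesGreenberg1996, §2 p. 143 (iii) with Thm. 2.13]
[cite: IovitaZaharescu1999, Thm. 1.2 (iii) and Def. 1.1 (pp. 236–237)]
[cite: GreenbergLNM1716, §2 p. 84] [cite: Tate1967, §3.2 Prop. 9] -/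
theorem deeplyRamified_cyclotomic_trace_holds : deeplyRamified_cyclotomic_trace.{0} :=
  deeplyRamified_cyclotomic_trace_of_cyclotomicZpExtension
    deeplyRamified_cyclotomicZpExtension_trace_holds

end Literature.NumberTheory.EllipticCurves.CoatesGreenberg1996
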